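import Literature.NumberTheory.LFunctions.KeiperLiZeroSum
import Literature.NumberTheory.LFunctions.ZetaZerosReflection
import HarnessLib

/-!
# Sekatskii's generalized Bombieri–Lagarias theorem and the generalized Li sums `k_{n,a}` (§2), PROVED

LABEL (line 1): **RH-EQUIVALENT** — a typed one-parameter FAMILY of criteria, `∀ n ≥ 1, k_{n,a} ≥ 0`,
each of which IS the Riemann hypothesis (Theorem 1, proved here), resting on a zero-location theorem
about arbitrary weighted families of complex numbers (Theorem 2, proved here).  bears_on: LADDER-RH L-C
(COLUMN 4, LI; criterion catalogue).  WHAT THIS IS NOT: for every `a ≠ ½` the inequality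
`k_{n,a} ≥ 0 ∀ n` is RH re-indexed (the case `a = 1`, equivalently `a = 0`, is Li's `λ_n ≥ 0`);
proving the equivalences fixes WHICH inequalities would prove RH and moves nothing; nothing here
bears on the truth of RH.

Source: S. K. Sekatskii, *Generalized Bombieri–Lagarias' theorem and generalized Li's criterion with
its arithmetic interpretation*, Ukr. Math. J. **66** (2014) 415–431 (= arXiv:1304.7895 with
arXiv:1305.1421) [Sekatskii2014], §2, Theorems 1–3.  Locators `pNN` are pages of the materialised
journal text (`lit read paper:doi-10-1007-s11253-014-0940-9`, 17 pp., p01 = journal p. 415).  §§3–4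
(the derivatives `(1/(n−1)!) dⁿ/dzⁿ[(z−a)^{n−1} log ξ(z)]|_{z=1−a}`, Theorems 5–7) are the sibling file
`SekatskiiGeneralizedLiCriterion.lean`.

## Dictionary (paper ↦ tree)

* Sekatskii's `ξ(z) = ½ z(z−1)π^{−z/2}Γ(z/2)ζ(z)` (p02, (2)) is the tree's `riemannXi`; its zeros "counted
  with multiplicities, complex-conjugate zeros paired" (p04, Thm 1) are the non-trivial zeros of `ζ`,
  typed — exactly as for Li's `λ_n` in `KeiperLiZeroSum.lean` (`keiperLiCoeff_eq_tsum_zeros`) — as the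
  subtype `ZetaZeros.riemannZetaNontrivialZeros` with multiplicity `m(ρ) = riemannZetaZeroOrder ρ`, the
  paired conditionally convergent `Σ_ρ [1 − wⁿ]` being the absolutely convergent `Σ' ρ, m(ρ)·Re[1 − wⁿ]`
  (the real parts ARE absolutely summable, `Sekatskii.summable_term`; the paired sum is real).
* "multiset `R` of complex numbers `ρ`" (Thm 2, p04) ↦ a family `ρ : ι → ℂ` with multiplicities
  `m : ι → ℕ`, `m_i ≥ 1`, as in the tree's `bombieriLagarias1999_theorem1` (no injectivity needed).
* Thm 2 (ii) `Σ_ρ (1 + |Re ρ|)/(1 + |ρ + a − 2σ|²) < ∞` ↦ `Summable (Sekatskii.weight a σ ρ m)`;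
  termwise within a factor `2` of Bombieri–Lagarias' `(1 + |·|)²` denominator, so the same condition.
* `k_{n,a} = Σ_ρ (1 − ((ρ − a)/(ρ + a − 1))ⁿ)` (p02 bottom, p04 Thm 1) ↦ `liSekatskiiSum a n`; the
  general ratio `(ρ − a)/(ρ + a − 2σ)` of Thms 2–3 is written out literally.

## Contents (source item ↦ declaration)

* Thm 2 (generalized Bombieri–Lagarias, p04), (a) ⟺ (b): `sekatskii2014_thm2_of_lt` (`a < σ`:
  `Re ρ ≤ σ ∀ρ`) and `sekatskii2014_thm2_of_gt` (`a > σ`, condition (a′): `Re ρ ≥ σ ∀ρ`) — PROVED, by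
  transporting the tree's `bombieriLagarias1999_theorem1` along the affine map
  `ρ ↦ ρ′ = (ρ − a)/(2(σ − a))` (`Sekatskii.rescale`): `(1 − 1/ρ′)⁻¹ = (ρ − a)/(ρ + a − 2σ)`,
  `Re ρ′ ≤ ½ ⟺ Re ρ ≤ σ` (resp. `≥ σ`), `ρ′ ≠ 1 ⟺ ρ ≠ 2σ − a` (hypothesis (i)), and the weights are
  comparable (`Sekatskii.summable_blWeight`).  One bookkeeping point the transport must respect: a
  member `ρ = a` contributes `m` to Sekatskii's sums (`((a−a)/(2a−2σ))ⁿ = 0`) but `0` to the tree's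
  Bombieri–Lagarias sums at `ρ′ = 0` (Lean's `1/0 = 0`); the finitely many such members are split off
  (`Sekatskii.term_eq_blTerm_add`) and absorbed by the bounded-below form
  `bombieriLagarias1999_theorem1_of_bddBelow`.  The bounded-below strengthening (a lower bound
  `−K`, uniform in `n`, already forces (a)) is `sekatskii2014_thm2_of_bddBelow_lt/_gt` — PROVED.
* Thm 2 (c) ⟹ (a) (a lower bound `−c(ε)e^{εn}` for every `ε > 0` suffices; this is Bombieri–Lagarias'
  condition (3), whose printed wording the tree's B–L file lacked): NAMED FACT `Sekatskii2014_thm2c`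
  (family level, both signs of `σ − a`), with its `ζ`-corollary PROVED from it
  (`riemannHypothesis_of_liSekatskiiSum_subexp`).  Discharge = the B–L 1999 §2 argument with the
  exponential slack kept (the tree's `BombieriLagarias.exists_tsum_lt` keeps only a constant).
* Thm 3 (generalized Li criterion for `2σ − ρ`-symmetric multisets, p05): `sekatskii2014_thm3` — PROVED
  from Thm 2 (typed for ONE `a ≠ σ`, symmetry as `∀ i, ∃ j, ρ_j = 2σ − ρ_i`; see the docstring for the
  printed redundancies).
* Thm 1 (p04): `sekatskii2014_thm1 : a ≠ ½ → (RiemannHypothesis ↔ ∀ n ≥ 1, 0 ≤ liSekatskiiSum a n)` —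
  PROVED (Thm 2 with `σ = ½` for the non-trivial zeros of `ζ`, `Sekatskii.summable_weight_zetaZeros`,
  and the reflection `ρ ↦ 1 − ρ̄`); bounded-below form `riemannHypothesis_of_liSekatskiiSum_bddBelow`.
* `liSekatskiiSum_one : k_{n,1} = λ_n` (`(ρ−1)/ρ = 1 − 1/ρ`, `keiperLiCoeff_eq_tsum_zeros`),
  `liSekatskiiSum_one_sub : k_{n,1−a} = k_{n,a}` (re-indexing by `ρ ↦ 1 − ρ`, multiplicities by
  `riemannZetaZeroOrder_one_sub_holds`; this is the first equality of the paper's (10), p15), hence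
  `liSekatskiiSum_zero : k_{n,0} = λ_n` — PROVED.

## Deliberately NOT here

Thm 4 (the "generalized Littlewood theorem" on `∮ log f · g`, p06 — a contour-integration tool from
Sekatskii–Beltraminelli–Merlini 2012, not a criterion); Remark 3 / the conformal-map variant (p09, not
pursued in the paper either); Thm 2–3 with the real parts omitted under conjugation symmetry (iii)/(iv)
(our sums are the real parts by construction).  Thms 5–7 and eq. (6): sibling file.

## References

* [Sekatskii2014] S. K. Sekatskii, Ukr. Math. J. 66 (2014) 415–431, §2, Thms 1–3 (pp. 416–420).
* [BombieriLagarias1999] E. Bombieri, J. C. Lagarias, J. Number Theory 77 (1999) 274–287, Thm 1.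
* [Li2004] X.-J. Li, Illinois J. Math. 48 (2004), Thm 2 (restating B–L Thm 1).
-/

noncomputable section

open Complex Filter Topology Set
open scoped ComplexConjugate

namespace Literature.NumberTheory.LFunctions

namespace Sekatskii

variable {ι : Type*} {ρ : ι → ℂ} {m : ι → ℕ} {a σ : ℝ}

/-! ### The affine transport `ρ ↦ ρ′ = (ρ − a)/(2(σ − a))` -/

/-- Sekatskii's convergence weight, hypothesis (ii) of Theorem 2:
`m(ρ) · (1 + |Re ρ|)/(1 + |ρ + a − 2σ|²)`. [cite: Sekatskii2014, Thm 2 (ii)] -/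
def weight (a σ : ℝ) (ρ : ι → ℂ) (m : ι → ℕ) (i : ι) : ℝ :=
  (m i : ℝ) * ((1 + |(ρ i).re|) / (1 + ‖ρ i + a - 2 * σ‖ ^ 2))

/-- The weight is non-negative. [cite: Sekatskii2014, Thm 2 (ii)] -/
theorem weight_nonneg (a σ : ℝ) (ρ : ι → ℂ) (m : ι → ℕ) (i : ι) : 0 ≤ weight a σ ρ m i := by
  unfold weight; positivity

/-- The affine change of variable `ρ′ = (ρ − a)/(2(σ − a))` sending `a ↦ 0`, `2σ − a ↦ 1`, `σ ↦ ½`,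
under which Sekatskii's ratio `(ρ − a)/(ρ + a − 2σ)` becomes Bombieri–Lagarias' `(1 − 1/ρ′)⁻¹`.
[cite: Sekatskii2014, §2, proof of Thm 2 (p. 418–419: "repeat the reasoning used above")] -/
def rescale (a σ : ℝ) (ρ : ℂ) : ℂ :=
  (ρ - a) / ((2 * (σ - a) : ℝ) : ℂ)

/-- `Re ρ′ = (Re ρ − a)/(2(σ − a))`. [folklore] -/
private theorem rescale_re (a σ : ℝ) (ρ : ℂ) : (rescale a σ ρ).re = (ρ.re - a) / (2 * (σ - a)) := by
  rw [rescale, Complex.div_ofReal_re, sub_re, ofReal_re]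

/-- For `a < σ`: `Re ρ′ ≤ ½ ⟺ Re ρ ≤ σ`. [folklore] -/
private theorem rescale_re_le_half_iff_of_lt (h : a < σ) (ρ : ℂ) :
    (rescale a σ ρ).re ≤ 1 / 2 ↔ ρ.re ≤ σ := by
  rw [rescale_re, div_le_iff₀ (by linarith)]
  constructor <;> intro h' <;> linarith

/-- For `σ < a`: `Re ρ′ ≤ ½ ⟺ σ ≤ Re ρ`. [folklore] -/
private theorem rescale_re_le_half_iff_of_gt (h : σ < a) (ρ : ℂ) :
    (rescale a σ ρ).re ≤ 1 / 2 ↔ σ ≤ ρ.re := by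
  rw [rescale_re, div_le_iff_of_neg (by linarith)]
  constructor <;> intro h' <;> linarith

/-- `ρ′ = 0 ⟺ ρ = a` (for `a ≠ σ`). [folklore] -/
private theorem rescale_eq_zero_iff (h : a ≠ σ) (ρ : ℂ) : rescale a σ ρ = 0 ↔ ρ = a := by
  have hc : ((2 * (σ - a) : ℝ) : ℂ) ≠ 0 := by
    exact_mod_cast show (2 * (σ - a) : ℝ) ≠ 0 from mul_ne_zero two_ne_zero (sub_ne_zero.2 (Ne.symm h))
  rw [rescale, div_eq_zero_iff, or_iff_left hc, sub_eq_zero]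

/-- `ρ′ ≠ 1` as soon as `ρ ≠ 2σ − a` (hypothesis (i) of Theorem 2). [cite: Sekatskii2014, Thm 2 (i)] -/
theorem rescale_ne_one (h : a ≠ σ) {ρ : ℂ} (hρ : ρ ≠ 2 * σ - a) : rescale a σ ρ ≠ 1 := by
  have hc : ((2 * (σ - a) : ℝ) : ℂ) ≠ 0 := by
    exact_mod_cast show (2 * (σ - a) : ℝ) ≠ 0 from mul_ne_zero two_ne_zero (sub_ne_zero.2 (Ne.symm h))
  intro h1
  rw [rescale, div_eq_one_iff_eq hc] at h1
  apply hρ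
  have := h1
  push_cast at this
  linear_combination this

/-- The key identity of the transport: `(ρ − a)/(ρ + a − 2σ) = (1 − 1/ρ′)⁻¹` for `ρ ≠ a` (at
`ρ = 2σ − a` both sides are Lean's junk value `0`).
[cite: Sekatskii2014, §2, p. 418–419] -/
theorem ratio_eq_inv_one_sub_inv_rescale (h : a ≠ σ) {ρ : ℂ} (hρa : ρ ≠ a) :
    (ρ - a) / (ρ + a - 2 * σ) = (1 - 1 / rescale a σ ρ)⁻¹ := by
  have hc : ((2 * (σ - a) : ℝ) : ℂ) ≠ 0 := by
    exact_mod_cast show (2 * (σ - a) : ℝ) ≠ 0 from mul_ne_zero two_ne_zero (sub_ne_zero.2 (Ne.symm h))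
  have h3 : (ρ - a : ℂ) ≠ 0 := sub_ne_zero.2 hρa
  rw [rescale, one_div, inv_div, one_sub_div h3, inv_div]
  congr 1
  push_cast
  ring

/-- If `ρ = a` the ratio vanishes: `(a − a)/(2a − 2σ) = 0`. [folklore] -/
private theorem ratio_eq_zero_of_eq {ρ : ℂ} (hρa : ρ = a) : (ρ - a) / (ρ + a - 2 * σ) = 0 := by
  rw [hρa, sub_self, zero_div]

/-- Under (a) (`a < σ`, `Re ρ ≤ σ`) resp. (a′) (`σ < a`, `Re ρ ≥ σ`) the ratio has modulus `≤ 1`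
(p. 417/419: `|(ρ−a)/(ρ+a−2σ)|² = 1 + 4(σ−a)(Re ρ−σ)/|ρ+a−2σ|²`). [cite: Sekatskii2014, §2, p. 417, 419] -/
theorem norm_ratio_le_one (h : a ≠ σ) {ρ : ℂ} (hρ : ρ ≠ 2 * σ - a)
    (hre : (rescale a σ ρ).re ≤ 1 / 2) : ‖(ρ - a) / (ρ + a - 2 * σ)‖ ≤ 1 := by
  by_cases hρa : ρ = a
  · rw [ratio_eq_zero_of_eq hρa, norm_zero]; exact zero_le_one
  rw [ratio_eq_inv_one_sub_inv_rescale h hρa]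
  exact (BombieriLagarias.norm_inv_one_sub_inv_le_one_iff (rescale_ne_one h hρ)).2 hre

/-- Comparison of the weights: Bombieri–Lagarias' weight of the rescaled family is dominated by a
constant multiple of Sekatskii's weight (ii). [cite: Sekatskii2014, Thm 2 (ii)] -/
theorem blWeight_rescale_le (h : a ≠ σ) (ρ : ι → ℂ) (m : ι → ℕ) (i : ι) :
    BombieriLagarias.weight (fun i ↦ rescale a σ (ρ i)) m i ≤
      ((1 + (1 + |a|) / |2 * (σ - a)|) * (1 + 2 * (2 * (σ - a)) ^ 2)) * weight a σ ρ m i := by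
  set c : ℝ := 2 * (σ - a) with hcdef
  have hc : c ≠ 0 := mul_ne_zero two_ne_zero (sub_ne_zero.2 (Ne.symm h))
  have hcpos : 0 < |c| := abs_pos.2 hc
  set K₁ : ℝ := 1 + (1 + |a|) / |c| with hK₁
  set K₂ : ℝ := 1 + 2 * c ^ 2 with hK₂
  have hK₁0 : 0 ≤ K₁ := by positivity
  have hK₂0 : 0 ≤ K₂ := by positivity
  -- numerator: `1 + |Re ρ′| ≤ K₁ (1 + |Re ρ|)`
  have hnum : 1 + |(rescale a σ (ρ i)).re| ≤ K₁ * (1 + |(ρ i).re|) := by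
    rw [rescale_re, ← hcdef, abs_div]
    have h1 : |(ρ i).re - a| ≤ |(ρ i).re| + |a| := abs_sub _ _
    have h2 : |(ρ i).re - a| / |c| ≤ (1 + |a|) / |c| * (1 + |(ρ i).re|) := by
      rw [div_mul_eq_mul_div, div_le_div_iff_of_pos_right hcpos]
      nlinarith [abs_nonneg (ρ i).re, abs_nonneg a]
    rw [hK₁]
    nlinarith [abs_nonneg (ρ i).re, h2]
  -- denominator: `1 + |ρ + a − 2σ|² ≤ K₂ (1 + |ρ′|)²`
  have hden : 1 + ‖ρ i + a - 2 * σ‖ ^ 2 ≤ K₂ * (1 + ‖rescale a σ (ρ i)‖) ^ 2 := by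
    have hn : ‖rescale a σ (ρ i)‖ = ‖ρ i - a‖ / |c| := by
      rw [rescale, norm_div, Complex.norm_real, Real.norm_eq_abs]
    have hsplit : ρ i + a - 2 * σ = (ρ i - a) - (c : ℂ) := by rw [hcdef]; push_cast; ring
    have htri : ‖ρ i + a - 2 * σ‖ ≤ ‖ρ i - a‖ + |c| := by
      rw [hsplit]
      exact (norm_sub_le _ _).trans (by rw [Complex.norm_real, Real.norm_eq_abs])
    have hsq : ‖ρ i + a - 2 * σ‖ ^ 2 ≤ 2 * ‖ρ i - a‖ ^ 2 + 2 * c ^ 2 := by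
      have h0 : 0 ≤ ‖ρ i + a - 2 * σ‖ := norm_nonneg _
      calc ‖ρ i + a - 2 * σ‖ ^ 2 ≤ (‖ρ i - a‖ + |c|) ^ 2 := pow_le_pow_left₀ h0 htri 2
        _ ≤ 2 * ‖ρ i - a‖ ^ 2 + 2 * |c| ^ 2 := by nlinarith [sq_nonneg (‖ρ i - a‖ - |c|)]
        _ = 2 * ‖ρ i - a‖ ^ 2 + 2 * c ^ 2 := by rw [sq_abs]
    have hge : 1 + (‖ρ i - a‖ / |c|) ^ 2 ≤ (1 + ‖rescale a σ (ρ i)‖) ^ 2 := by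
      rw [hn]
      nlinarith [div_nonneg (norm_nonneg (ρ i - a)) hcpos.le]
    have hc2 : 0 < c ^ 2 := by positivity
    have hmid : 1 + ‖ρ i + a - 2 * σ‖ ^ 2 ≤ K₂ * (1 + (‖ρ i - a‖ / |c|) ^ 2) := by
      rw [div_pow, sq_abs, hK₂]
      have : 2 * ‖ρ i - a‖ ^ 2 ≤ (1 + 2 * c ^ 2) * (‖ρ i - a‖ ^ 2 / c ^ 2) := by
        rw [mul_div_assoc']
        rw [le_div_iff₀ hc2]
        nlinarith [sq_nonneg ‖ρ i - a‖]
      nlinarith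
    exact hmid.trans (mul_le_mul_of_nonneg_left hge hK₂0)
  -- assemble
  unfold BombieriLagarias.weight weight
  have hm0 : (0 : ℝ) ≤ m i := Nat.cast_nonneg _
  have hpos1 : 0 < (1 + ‖rescale a σ (ρ i)‖) ^ 2 := by positivity
  have hpos2 : 0 < 1 + ‖ρ i + a - 2 * σ‖ ^ 2 := by positivity
  have hfrac : 1 / (1 + ‖rescale a σ (ρ i)‖) ^ 2 ≤ K₂ / (1 + ‖ρ i + a - 2 * σ‖ ^ 2) := by
    rw [div_le_div_iff₀ hpos1 hpos2, one_mul]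
    exact hden
  calc (m i : ℝ) * ((1 + |(rescale a σ (ρ i)).re|) / (1 + ‖rescale a σ (ρ i)‖) ^ 2)
      = (m i : ℝ) * ((1 + |(rescale a σ (ρ i)).re|) * (1 / (1 + ‖rescale a σ (ρ i)‖) ^ 2)) := by
        rw [mul_one_div]
    _ ≤ (m i : ℝ) * ((K₁ * (1 + |(ρ i).re|)) * (K₂ / (1 + ‖ρ i + a - 2 * σ‖ ^ 2))) :=
        mul_le_mul_of_nonneg_left
          (mul_le_mul hnum hfrac (by positivity) (mul_nonneg hK₁0 (by positivity))) hm0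
    _ = (K₁ * K₂) * ((m i : ℝ) * ((1 + |(ρ i).re|) / (1 + ‖ρ i + a - 2 * σ‖ ^ 2))) := by ring

/-- Sekatskii's hypothesis (ii) implies Bombieri–Lagarias' hypothesis for the rescaled family.
[cite: Sekatskii2014, Thm 2 (ii)] -/
theorem summable_blWeight (h : a ≠ σ) (hR : Summable (weight a σ ρ m)) :
    Summable (BombieriLagarias.weight (fun i ↦ rescale a σ (ρ i)) m) :=
  Summable.of_nonneg_of_le (fun i ↦ BombieriLagarias.weight_nonneg _ _ i)
    (fun i ↦ blWeight_rescale_le h ρ m i) (hR.mul_left _)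

/-- Under (ii) only finitely many members of the family sit at the point `a` (there the weight is
`≥ 1/(1 + (2a − 2σ)²)`). [folklore] -/
private theorem finite_setOf_eq (hm : ∀ i, 0 < m i) (hR : Summable (weight a σ ρ m)) :
    {i | ρ i = a}.Finite := by
  set δ : ℝ := 1 / (1 + (2 * a - 2 * σ) ^ 2) with hδ
  have hδ0 : 0 < δ := by positivity
  have hev := hR.tendsto_cofinite_zero.eventually (gt_mem_nhds hδ0)
  refine (Filter.eventually_cofinite.1 hev).subset fun i (hi : ρ i = a) ↦ ?_
  simp only [Set.mem_setOf_eq, not_lt]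
  have hm1 : (1 : ℝ) ≤ m i := by exact_mod_cast hm i
  have hnorm : ‖ρ i + a - 2 * σ‖ ^ 2 = (2 * a - 2 * σ) ^ 2 := by
    rw [hi, show (a : ℂ) + a - 2 * σ = ((2 * a - 2 * σ : ℝ) : ℂ) by push_cast; ring,
      Complex.norm_real, Real.norm_eq_abs, sq_abs]
  unfold weight
  rw [hnorm, hi, ofReal_re, hδ]
  calc 1 / (1 + (2 * a - 2 * σ) ^ 2) = 1 * ((1 + 0) / (1 + (2 * a - 2 * σ) ^ 2)) := by ring
    _ ≤ (m i : ℝ) * ((1 + |a|) / (1 + (2 * a - 2 * σ) ^ 2)) := by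
        gcongr
        exact abs_nonneg a

/-- The correction term at the members `ρ_i = a`: `m_i` there, `0` elsewhere. [folklore] -/
def extra (a : ℝ) (ρ : ι → ℂ) (m : ι → ℕ) (i : ι) : ℝ :=
  if ρ i = a then (m i : ℝ) else 0

/-- The correction term is non-negative. [folklore] -/
private theorem extra_nonneg (a : ℝ) (ρ : ι → ℂ) (m : ι → ℕ) (i : ι) : 0 ≤ extra a ρ m i := by
  unfold extra; split_ifs <;> positivity

/-- The correction term is summable (finite support). [folklore] -/
private theorem summable_extra (hm : ∀ i, 0 < m i) (hR : Summable (weight a σ ρ m)) :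
    Summable (extra a ρ m) := by
  classical
  refine summable_of_ne_finset_zero (s := (finite_setOf_eq hm hR).toFinset) fun i hi ↦ ?_
  simp only [Set.Finite.mem_toFinset, Set.mem_setOf_eq] at hi
  simp [extra, hi]

/-- Termwise transport (`n ≥ 1`): Sekatskii's term is Bombieri–Lagarias' term of the rescaled
family plus the correction at `ρ_i = a` (where Sekatskii's ratio is `0` and the term is `m_i`, while
Lean's `1/0 = 0` makes the B–L term `0`). [cite: Sekatskii2014, §2, p. 418–419] -/
theorem term_eq_blTerm_add (h : a ≠ σ) {n : ℕ} (hn : 1 ≤ n) (i : ι) :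
    (m i : ℝ) * (1 - ((ρ i - a) / (ρ i + a - 2 * σ)) ^ n).re =
      (m i : ℝ) * (1 - (1 - 1 / rescale a σ (ρ i))⁻¹ ^ n).re + extra a ρ m i := by
  by_cases hρa : ρ i = a
  · have h0 : rescale a σ (ρ i) = 0 := (rescale_eq_zero_iff h _).2 hρa
    rw [ratio_eq_zero_of_eq hρa, h0, extra, if_pos hρa, zero_pow (by omega)]
    simp
  · rw [ratio_eq_inv_one_sub_inv_rescale h hρa, extra, if_neg hρa, add_zero]

/-- **Absolute convergence of Sekatskii's sums**: under (ii) the real parts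
`m_i · Re[1 − ((ρ_i − a)/(ρ_i + a − 2σ))ⁿ]` are absolutely summable for every `n` ((i) is not needed
for this: at a member `ρ_i = 2σ − a` both Sekatskii's term and the transported one take Lean's junk
value `m_i`).
[cite: Sekatskii2014, Thm 2] -/
theorem summable_term (h : a ≠ σ) (hm : ∀ i, 0 < m i)
    (hR : Summable (weight a σ ρ m)) (n : ℕ) :
    Summable fun i ↦ (m i : ℝ) * (1 - ((ρ i - a) / (ρ i + a - 2 * σ)) ^ n).re := by
  rcases Nat.eq_zero_or_pos n with rfl | hn
  · simp only [pow_zero, sub_self, zero_re, mul_zero]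
    exact summable_zero
  have hbl := BombieriLagarias.summable_term hm (summable_blWeight h hR) n
  simpa only [term_eq_blTerm_add h hn] using hbl.add (summable_extra hm hR)

/-- The sums themselves: Sekatskii's sum is the Bombieri–Lagarias sum of the rescaled family plus
the non-negative constant `Σ_{ρ_i = a} m_i` (`n ≥ 1`). [cite: Sekatskii2014, §2, p. 418–419] -/
theorem tsum_term_eq (h : a ≠ σ) (hm : ∀ i, 0 < m i)
    (hR : Summable (weight a σ ρ m)) {n : ℕ} (hn : 1 ≤ n) :
    ∑' i, (m i : ℝ) * (1 - ((ρ i - a) / (ρ i + a - 2 * σ)) ^ n).re =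
      (∑' i, (m i : ℝ) * (1 - (1 - 1 / rescale a σ (ρ i))⁻¹ ^ n).re) + ∑' i, extra a ρ m i := by
  rw [← Summable.tsum_add (BombieriLagarias.summable_term hm (summable_blWeight h hR) n)
    (summable_extra hm hR)]
  exact tsum_congr fun i ↦ term_eq_blTerm_add h hn i

/-- Core of (b) ⟹ (a), in bounded-below form: if Sekatskii's sums are `≥ −K` for all `n ≥ 1` then
every rescaled member has `Re ρ′ ≤ ½`. [cite: Sekatskii2014, Thm 2, proof (p. 417, 419)] -/
theorem rescale_re_le_half_of_bddBelow (h : a ≠ σ) (hm : ∀ i, 0 < m i) (h1 : ∀ i, ρ i ≠ 2 * σ - a)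
    (hR : Summable (weight a σ ρ m)) {K : ℝ}
    (hK : ∀ n : ℕ, 1 ≤ n → -K ≤ ∑' i, (m i : ℝ) * (1 - ((ρ i - a) / (ρ i + a - 2 * σ)) ^ n).re) :
    ∀ i, (rescale a σ (ρ i)).re ≤ 1 / 2 := by
  have hE0 : 0 ≤ ∑' i, extra a ρ m i := tsum_nonneg (extra_nonneg a ρ m)
  refine bombieriLagarias1999_theorem1_of_bddBelow (fun i ↦ rescale a σ (ρ i)) m hm
    (fun i ↦ rescale_ne_one h (h1 i)) (summable_blWeight h hR) (K := K + ∑' i, extra a ρ m i) ?_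
  intro n hn
  have := hK n hn
  rw [tsum_term_eq h hm hR hn] at this
  linarith

end Sekatskii

open Sekatskii

/-! ### Theorem 2 — the generalized Bombieri–Lagarias theorem -/

/-- **Sekatskii 2014, Theorem 2 (generalized Bombieri–Lagarias theorem), case `a < σ`, (a) ⟺ (b)**
(p. 418): "Let `a` and `σ` be arbitrary real numbers, `a < σ`, and let `R` be a multiset of complex
numbers `ρ` such that (i) `2σ − a ∉ R`; (ii) `Σ_ρ (1 + |Re ρ|)/(1 + |ρ + a − 2σ|²) < +∞`.  Then the
following conditions are equivalent: (a) `Re ρ ≤ σ` for every `ρ`; (b)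
`Σ_ρ Re(1 − ((ρ − a)/(ρ − 2σ + a))ⁿ) ≥ 0` for `n = 1, 2, 3, …`."  Typed for a family `ρ : ι → ℂ` with
multiplicities `m_i ≥ 1`, the sums being the absolutely convergent `Σ' i, m_i·Re[…]`
(`Sekatskii.summable_term`).  PROVED by transport of `bombieriLagarias1999_theorem1` along
`ρ ↦ (ρ − a)/(2(σ − a))`.  (Bombieri–Lagarias' theorem is the case `a = 0, σ = ½` after `ρ ↦ 1 − ρ̄`,
or `a = 1, σ = ½` directly.) [cite: Sekatskii2014, Thm 2] -/
theorem sekatskii2014_thm2_of_lt {ι : Type*} (ρ : ι → ℂ) (m : ι → ℕ) {a σ : ℝ} (haσ : a < σ)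
    (hm : ∀ i, 0 < m i) (h1 : ∀ i, ρ i ≠ 2 * σ - a) (hR : Summable (Sekatskii.weight a σ ρ m)) :
    (∀ i, (ρ i).re ≤ σ) ↔
      ∀ n : ℕ, 1 ≤ n → 0 ≤ ∑' i, (m i : ℝ) * (1 - ((ρ i - a) / (ρ i + a - 2 * σ)) ^ n).re := by
  constructor
  · intro h n _
    exact tsum_nonneg fun i ↦ mul_nonneg (Nat.cast_nonneg _)
      (BombieriLagarias.re_one_sub_pow_nonneg
        (norm_ratio_le_one haσ.ne (h1 i) ((rescale_re_le_half_iff_of_lt haσ _).2 (h i))) n)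
  · intro h i
    exact (rescale_re_le_half_iff_of_lt haσ _).1
      (rescale_re_le_half_of_bddBelow haσ.ne hm h1 hR (K := 0) (fun n hn ↦ by simpa using h n hn) i)

/-- **Sekatskii 2014, Theorem 2, case `a > σ`, (a′) ⟺ (b)** (p. 418): "If, under the same conditions,
`a > σ` is taken, then the point (a) should be changed into (a′) `Re ρ ≥ σ` for every `ρ`; the points
(b) and (c) remain unchanged."  PROVED (same transport; for `σ < a` the map `ρ ↦ (ρ − a)/(2(σ − a))`
reverses the half-planes). [cite: Sekatskii2014, Thm 2 (a′)] -/
theorem sekatskii2014_thm2_of_gt {ι : Type*} (ρ : ι → ℂ) (m : ι → ℕ) {a σ : ℝ} (hσa : σ < a)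
    (hm : ∀ i, 0 < m i) (h1 : ∀ i, ρ i ≠ 2 * σ - a) (hR : Summable (Sekatskii.weight a σ ρ m)) :
    (∀ i, σ ≤ (ρ i).re) ↔
      ∀ n : ℕ, 1 ≤ n → 0 ≤ ∑' i, (m i : ℝ) * (1 - ((ρ i - a) / (ρ i + a - 2 * σ)) ^ n).re := by
  constructor
  · intro h n _
    exact tsum_nonneg fun i ↦ mul_nonneg (Nat.cast_nonneg _)
      (BombieriLagarias.re_one_sub_pow_nonneg
        (norm_ratio_le_one hσa.ne' (h1 i) ((rescale_re_le_half_iff_of_gt hσa _).2 (h i))) n)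
  · intro h i
    exact (rescale_re_le_half_iff_of_gt hσa _).1
      (rescale_re_le_half_of_bddBelow hσa.ne' hm h1 hR (K := 0) (fun n hn ↦ by simpa using h n hn) i)

/-- **Theorem 2 with the weaker hypothesis of boundedness below, case `a < σ`**: a lower bound `−K`
for Sekatskii's sums, uniform in `n ≥ 1`, already forces (a) `Re ρ ≤ σ ∀ρ` — the constant-bound special
case of condition (c) (cf. `bombieriLagarias1999_theorem1_of_bddBelow`). PROVED.
[cite: Sekatskii2014, Thm 2 (c) (special case of a constant lower bound)] -/
theorem sekatskii2014_thm2_of_bddBelow_lt {ι : Type*} (ρ : ι → ℂ) (m : ι → ℕ) {a σ : ℝ}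
    (haσ : a < σ) (hm : ∀ i, 0 < m i) (h1 : ∀ i, ρ i ≠ 2 * σ - a)
    (hR : Summable (Sekatskii.weight a σ ρ m)) {K : ℝ}
    (hK : ∀ n : ℕ, 1 ≤ n → -K ≤ ∑' i, (m i : ℝ) * (1 - ((ρ i - a) / (ρ i + a - 2 * σ)) ^ n).re) :
    ∀ i, (ρ i).re ≤ σ := fun i ↦
  (rescale_re_le_half_iff_of_lt haσ _).1 (rescale_re_le_half_of_bddBelow haσ.ne hm h1 hR hK i)

/-- **Theorem 2 with the weaker hypothesis of boundedness below, case `a > σ`**: a uniform lower bound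
`−K` forces (a′) `Re ρ ≥ σ ∀ρ`. PROVED. [cite: Sekatskii2014, Thm 2 (c) (special case), (a′)] -/
theorem sekatskii2014_thm2_of_bddBelow_gt {ι : Type*} (ρ : ι → ℂ) (m : ι → ℕ) {a σ : ℝ}
    (hσa : σ < a) (hm : ∀ i, 0 < m i) (h1 : ∀ i, ρ i ≠ 2 * σ - a)
    (hR : Summable (Sekatskii.weight a σ ρ m)) {K : ℝ}
    (hK : ∀ n : ℕ, 1 ≤ n → -K ≤ ∑' i, (m i : ℝ) * (1 - ((ρ i - a) / (ρ i + a - 2 * σ)) ^ n).re) :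
    ∀ i, σ ≤ (ρ i).re := fun i ↦
  (rescale_re_le_half_iff_of_gt hσa _).1 (rescale_re_le_half_of_bddBelow hσa.ne' hm h1 hR hK i)

/-- **Sekatskii 2014, Theorem 2, (c) ⟹ (a)/(a′)** (p. 418) — NAMED FACT (not proved here): "(c) for
every fixed `ε > 0`, there is a positive constant `c(ε)` such that
`Σ_ρ Re(1 − ((ρ − a)/(ρ − 2σ + a))ⁿ) ≥ −c(ε)e^{εn}`, `n = 1, 2, 3, …`" is equivalent to (a) (for
`a < σ`) resp. (a′) (for `a > σ`).  ((a) ⟹ (b) ⟹ (c) is trivial given `sekatskii2014_thm2_of_lt/_gt`;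
the content is (c) ⟹ (a): this is Bombieri–Lagarias' condition (3) of their Theorem 1 transported,
whose proof is B–L 1999 §2 with the exponential main term `(M_B/2)λⁿ`, `λ > 1`, beating `c(ε)e^{εn}` for
`ε < log λ`; the tree's `BombieriLagarias.exists_tsum_lt` records only the constant-bound version, so
this direction is vendored as a fact, stated for index types in a fixed universe `u`.)
[cite: Sekatskii2014, Thm 2 (c)] -/
def Sekatskii2014_thm2c.{u} : Prop :=
  ∀ {ι : Type u} (ρ : ι → ℂ) (m : ι → ℕ) (a σ : ℝ), a ≠ σ → (∀ i, 0 < m i) →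
    (∀ i, ρ i ≠ 2 * σ - a) → Summable (Sekatskii.weight a σ ρ m) →
    (∀ ε : ℝ, 0 < ε → ∃ c : ℝ, 0 < c ∧ ∀ n : ℕ, 1 ≤ n →
      -c * Real.exp (ε * n) ≤ ∑' i, (m i : ℝ) * (1 - ((ρ i - a) / (ρ i + a - 2 * σ)) ^ n).re) →
    (a < σ → ∀ i, (ρ i).re ≤ σ) ∧ (σ < a → ∀ i, σ ≤ (ρ i).re)

/-! ### Theorem 3 — the generalized Li criterion for symmetric multisets -/

/-- **Sekatskii 2014, Theorem 3 (generalized Li's criterion)** (p. 419): for a real `a ≠ σ` and a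
multiset `R` with (i) `2σ − a ∉ R`, (ii) `Σ_ρ (1 + |Re ρ|)/(1 + |ρ + a − 2σ|²) < ∞`, (iii) "if `ρ ∈ R`
then `2σ − ρ ∈ R`", the following are equivalent: (a) `Re ρ = σ` for every `ρ`; (b)
`Σ_ρ Re(1 − ((ρ − a)/(ρ + a − 2σ))ⁿ) ≥ 0` for `n = 1, 2, 3, …` ("Clearly, in the conditions of the
theorem, for all `ρ` we have `Re ρ ≤ σ` and `Re(2σ − ρ) ≤ σ`, whence `Re ρ = σ`.")  Typed for ONE
`a ≠ σ` (the printed hypotheses also list `a ∉ R` and the mirror summability, i.e. (i)–(ii) for the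
mirror parameter `2σ − a`, and (b) "for any `a`"; one parameter suffices and is what the printed proof
uses), with (iii) as `∀ i, ∃ j, ρ_j = 2σ − ρ_i` (multiplicities are not needed).  PROVED from Theorem 2.
[cite: Sekatskii2014, Thm 3] -/
theorem sekatskii2014_thm3 {ι : Type*} (ρ : ι → ℂ) (m : ι → ℕ) {a σ : ℝ} (haσ : a ≠ σ)
    (hm : ∀ i, 0 < m i) (h1 : ∀ i, ρ i ≠ 2 * σ - a) (hR : Summable (Sekatskii.weight a σ ρ m))
    (hsymm : ∀ i, ∃ j, ρ j = 2 * σ - ρ i) :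
    (∀ i, (ρ i).re = σ) ↔
      ∀ n : ℕ, 1 ≤ n → 0 ≤ ∑' i, (m i : ℝ) * (1 - ((ρ i - a) / (ρ i + a - 2 * σ)) ^ n).re := by
  rcases lt_or_gt_of_ne haσ with hlt | hgt
  · rw [← sekatskii2014_thm2_of_lt ρ m hlt hm h1 hR]
    constructor
    · exact fun h i ↦ (h i).le
    · intro h i
      obtain ⟨j, hj⟩ := hsymm i
      have hji := h j
      rw [hj, sub_re] at hji
      norm_num at hji
      exact le_antisymm (h i) (by linarith)
  · rw [← sekatskii2014_thm2_of_gt ρ m hgt hm h1 hR]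
    constructor
    · exact fun h i ↦ (h i).ge
    · intro h i
      obtain ⟨j, hj⟩ := hsymm i
      have hji := h j
      rw [hj, sub_re] at hji
      norm_num at hji
      exact le_antisymm (by linarith) (h i)

/-! ### Theorem 1 — the sums `k_{n,a}` over the zeros of `ξ` -/

/-- **Sekatskii's generalized Li sums** `k_{n,a} = Σ_ρ (1 − ((ρ − a)/(ρ + a − 1))ⁿ)` over the zeros of
`ξ` "counted with regard for their multiplicities, complex-conjugate zeros paired" (p. 416 bottom,
p. 418 Thm 1), typed as the absolutely convergent sum of real parts over the non-trivial zeros of `ζ`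
with multiplicity `m(ρ)` (`Sekatskii.summable_term_zetaZeros`).  `k_{n,1} = k_{n,0} = λ_n`
(`liSekatskiiSum_one`, `liSekatskiiSum_zero`). [cite: Sekatskii2014, §2 and Thm 1] -/
def liSekatskiiSum (a : ℝ) (n : ℕ) : ℝ :=
  ∑' ρ : ZetaZeros.riemannZetaNontrivialZeros,
    (riemannZetaZeroOrder (ρ : ℂ) : ℝ) * (1 - (((ρ : ℂ) - a) / ((ρ : ℂ) + a - 1)) ^ n).re

namespace Sekatskii

open ZetaZeros

/-- Multiplicity of a non-trivial zero as a natural number. [folklore] -/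
private theorem toNat_cast_order (ρ : ZetaZeros.riemannZetaNontrivialZeros) :
    (((riemannZetaZeroOrder (ρ : ℂ)).toNat : ℕ) : ℝ) = (riemannZetaZeroOrder (ρ : ℂ) : ℝ) := by
  have h := riemannZetaNontrivialZeros.one_le_order ρ.2
  have : ((riemannZetaZeroOrder (ρ : ℂ)).toNat : ℤ) = riemannZetaZeroOrder (ρ : ℂ) :=
    Int.toNat_of_nonneg (by omega)
  exact_mod_cast this

/-- The multiplicities are positive. [folklore] -/
private theorem toNat_order_pos (ρ : ZetaZeros.riemannZetaNontrivialZeros) :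
    0 < (riemannZetaZeroOrder (ρ : ℂ)).toNat := by
  have := riemannZetaNontrivialZeros.one_le_order ρ.2; omega

/-- A non-trivial zero is not a real number (its imaginary part is non-zero), in particular
`ρ ≠ 2σ − a` for real `a, σ` — hypothesis (i) is automatic. [folklore] -/
private theorem coe_ne_real (ρ : ZetaZeros.riemannZetaNontrivialZeros) (x : ℝ) : (ρ : ℂ) ≠ x := by
  intro h
  have := riemannZetaNontrivialZeros.im_ne_zero ρ.2
  rw [h, ofReal_im] at this
  exact this rfl

/-- Hypothesis (i) for the zeros of `ζ`: `ρ ≠ 2σ − a`. [folklore] -/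
private theorem coe_ne_two_mul_sub (ρ : ZetaZeros.riemannZetaNontrivialZeros) (a σ : ℝ) :
    (ρ : ℂ) ≠ 2 * σ - a := by
  have := coe_ne_real ρ (2 * σ - a)
  push_cast at this
  exact this

/-- **Hypothesis (ii) for the zeros of `ζ`** (any real `a`, `σ`):
`Σ_ρ m(ρ)(1 + |Re ρ|)/(1 + |ρ + a − 2σ|²) ≤ 2 Σ_ρ m(ρ)/(1 + γ²) < ∞`. [cite: Sekatskii2014, Thm 1 ("just due to their known density", p. 417)] -/
theorem summable_weight_zetaZeros (a σ : ℝ) :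
    Summable (weight a σ (fun ρ : ZetaZeros.riemannZetaNontrivialZeros ↦ (ρ : ℂ))
      (fun ρ ↦ (riemannZetaZeroOrder (ρ : ℂ)).toNat)) := by
  refine Summable.of_nonneg_of_le (fun ρ ↦ weight_nonneg _ _ _ _ ρ) (fun ρ ↦ ?_)
    (ZetaZeroSum.summable_zeroOrder_div_one_add_sq.mul_left 2)
  have h0 := riemannZetaNontrivialZeros.re_pos ρ.2
  have h1 := riemannZetaNontrivialZeros.re_lt_one ρ.2
  unfold weight
  rw [toNat_cast_order]
  have hm0 : (0 : ℝ) ≤ riemannZetaZeroOrder (ρ : ℂ) := by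
    have := riemannZetaNontrivialZeros.one_le_order ρ.2
    exact_mod_cast (show (0 : ℤ) ≤ _ by omega)
  have hre : 1 + |(ρ : ℂ).re| ≤ 2 := by rw [abs_of_pos h0]; linarith
  have him : (ρ : ℂ).im ^ 2 ≤ ‖(ρ : ℂ) + a - 2 * σ‖ ^ 2 := by
    have h := Complex.abs_im_le_norm ((ρ : ℂ) + a - 2 * σ)
    have him' : ((ρ : ℂ) + a - 2 * σ).im = (ρ : ℂ).im := by simp
    rw [him'] at h
    calc (ρ : ℂ).im ^ 2 = |(ρ : ℂ).im| ^ 2 := (sq_abs _).symm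
      _ ≤ _ := pow_le_pow_left₀ (abs_nonneg _) h 2
  have hpos : 0 < 1 + (ρ : ℂ).im ^ 2 := by positivity
  calc (riemannZetaZeroOrder (ρ : ℂ) : ℝ) *
        ((1 + |(ρ : ℂ).re|) / (1 + ‖(ρ : ℂ) + a - 2 * σ‖ ^ 2))
      ≤ (riemannZetaZeroOrder (ρ : ℂ) : ℝ) * (2 / (1 + (ρ : ℂ).im ^ 2)) := by
        gcongr
    _ = 2 * ((riemannZetaZeroOrder (ρ : ℂ) : ℝ) / (1 + (ρ : ℂ).im ^ 2)) := by ring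

/-- The literal `σ = ½` ratio is `(ρ − a)/(ρ + a − 1)`. [folklore] -/
private theorem ratio_half (ρ : ℂ) (a : ℝ) :
    (ρ - a) / (ρ + a - 2 * ((1 / 2 : ℝ) : ℂ)) = (ρ - a) / (ρ + a - 1) := by
  congr 1; push_cast; ring

/-- `k_{n,a}` is the `σ = ½` instance of the family sums of Theorem 2 for the zeros of `ζ`. [folklore] -/
private theorem liSekatskiiSum_eq_tsum (a : ℝ) (n : ℕ) :
    liSekatskiiSum a n = ∑' ρ : ZetaZeros.riemannZetaNontrivialZeros,
      ((riemannZetaZeroOrder (ρ : ℂ)).toNat : ℝ) *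
        (1 - (((ρ : ℂ) - a) / ((ρ : ℂ) + a - 2 * ((1 / 2 : ℝ) : ℂ))) ^ n).re := by
  unfold liSekatskiiSum
  exact tsum_congr fun ρ ↦ by rw [toNat_cast_order, ratio_half]

/-- **Absolute convergence of `k_{n,a}`** as a sum of real parts with multiplicities.
[cite: Sekatskii2014, Thm 1] -/
theorem summable_term_zetaZeros (a : ℝ) (n : ℕ) :
    Summable fun ρ : ZetaZeros.riemannZetaNontrivialZeros ↦
      (riemannZetaZeroOrder (ρ : ℂ) : ℝ) * (1 - (((ρ : ℂ) - a) / ((ρ : ℂ) + a - 1)) ^ n).re := by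
  by_cases ha : a = 1 / 2
  · refine (summable_zero (β := ZetaZeros.riemannZetaNontrivialZeros) (α := ℝ)).congr fun ρ ↦ ?_
    have h1 : ((ρ : ℂ) - a) / ((ρ : ℂ) + a - 1) = 1 := by
      rw [ha, div_eq_one_iff_eq]
      · push_cast; ring
      · have := coe_ne_real ρ (1 / 2)
        intro h0; apply this; push_cast at h0 ⊢; linear_combination h0
    simp [h1]
  have h := summable_term (ρ := fun ρ : ZetaZeros.riemannZetaNontrivialZeros ↦ (ρ : ℂ))
    (m := fun ρ ↦ (riemannZetaZeroOrder (ρ : ℂ)).toNat) (a := a) (σ := 1 / 2) ha toNat_order_pos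
    (summable_weight_zetaZeros a (1 / 2)) n
  exact h.congr fun ρ ↦ by simp only [toNat_cast_order, ratio_half]

/-- RH says every non-trivial zero has `Re ρ ≤ ½`; conversely this one-sided statement is RH by the
reflection `ρ ↦ 1 − ρ̄` of the non-trivial zeros (Titchmarsh §2.12; the step "`Re ρ ≤ σ` and
`Re(2σ − ρ) ≤ σ`, whence `Re ρ = σ`" of Sekatskii's Thm 3). [cite: Sekatskii2014, Thm 3 (proof, p. 419)] -/
theorem riemannHypothesis_iff_forall_re_le_half :
    RiemannHypothesis ↔ ∀ ρ : ZetaZeros.riemannZetaNontrivialZeros, (ρ : ℂ).re ≤ 1 / 2 := by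
  constructor
  · intro hRH ρ
    obtain ⟨hz, hnt⟩ := ρ.2
    exact (hRH (ρ : ℂ) hz (fun ⟨k, hk⟩ ↦ hnt ⟨k, hk.symm⟩)
      (riemannZetaNontrivialZeros.ne_one ρ.2)).le
  · intro h s hs htriv _
    have hmem : s ∈ ZetaZeros.riemannZetaNontrivialZeros :=
      ⟨hs, by rintro ⟨k, hk⟩; exact htriv ⟨k, hk.symm⟩⟩
    have hle := h ⟨s, hmem⟩
    have hge := h ⟨1 - conj s, riemannZetaNontrivialZeros.one_sub_conj_mem hmem⟩
    simp only [sub_re, one_re, Complex.conj_re] at hge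
    simp only at hle
    linarith

/-- Dually: RH iff every non-trivial zero has `Re ρ ≥ ½` (reflection `ρ ↦ 1 − ρ̄`).
[cite: Sekatskii2014, Thm 3 (proof, p. 419)] -/
theorem riemannHypothesis_iff_forall_half_le_re :
    RiemannHypothesis ↔ ∀ ρ : ZetaZeros.riemannZetaNontrivialZeros, 1 / 2 ≤ (ρ : ℂ).re := by
  rw [riemannHypothesis_iff_forall_re_le_half]
  constructor
  · intro h ρ
    have := h ⟨1 - conj (ρ : ℂ), riemannZetaNontrivialZeros.one_sub_conj_mem ρ.2⟩
    simp only [sub_re, one_re, Complex.conj_re] at this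
    linarith
  · intro h ρ
    have := h ⟨1 - conj (ρ : ℂ), riemannZetaNontrivialZeros.one_sub_conj_mem ρ.2⟩
    simp only [sub_re, one_re, Complex.conj_re] at this
    linarith

end Sekatskii

/-- **Sekatskii 2014, Theorem 1** (p. 418): "The Riemann hypothesis is equivalent to the nonnegativity
of the sums `k_{n,a} = Σ_ρ (1 − ((ρ − a)/(ρ + a − 1))ⁿ) = Σ_ρ (1 − (1 − (2a − 1)/(ρ + a − 1))ⁿ)` taken
over the zeros of the Riemann xi-function for any real `a`, except `a = ½`.  Here `n` is a nonnegative
integer, the zeros are counted with regard for their multiplicities, and, for `n = 1`, the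
contributions of complex conjugate zeros should be paired when summing."  (`n = 0` gives `k = 0` and is
vacuous; typed for `n ≥ 1`.)  PROVED: Theorem 2 with `σ = ½` applied to the non-trivial zeros of `ζ`
(hypothesis (i) is automatic since the zeros are non-real, (ii) is `Σ m(ρ)/(1+γ²) < ∞`), and
`Re ρ ≤ ½ ∀ρ ⟺ RH ⟺ Re ρ ≥ ½ ∀ρ` by the reflection `ρ ↦ 1 − ρ̄`.  For `a = 1` (or `a = 0`) this is Li's
criterion (`liSekatskiiSum_one`, tree `li_criterion_holds`). [cite: Sekatskii2014, Thm 1] -/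
theorem sekatskii2014_thm1 {a : ℝ} (ha : a ≠ 1 / 2) :
    RiemannHypothesis ↔ ∀ n : ℕ, 1 ≤ n → 0 ≤ liSekatskiiSum a n := by
  simp only [Sekatskii.liSekatskiiSum_eq_tsum]
  rcases lt_or_gt_of_ne ha with hlt | hgt
  · rw [Sekatskii.riemannHypothesis_iff_forall_re_le_half]
    exact sekatskii2014_thm2_of_lt (fun ρ : ZetaZeros.riemannZetaNontrivialZeros ↦ (ρ : ℂ))
      (fun ρ ↦ (riemannZetaZeroOrder (ρ : ℂ)).toNat) hlt Sekatskii.toNat_order_pos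
      (fun ρ ↦ Sekatskii.coe_ne_two_mul_sub ρ a (1 / 2)) (Sekatskii.summable_weight_zetaZeros a (1 / 2))
  · rw [Sekatskii.riemannHypothesis_iff_forall_half_le_re]
    exact sekatskii2014_thm2_of_gt (fun ρ : ZetaZeros.riemannZetaNontrivialZeros ↦ (ρ : ℂ))
      (fun ρ ↦ (riemannZetaZeroOrder (ρ : ℂ)).toNat) hgt Sekatskii.toNat_order_pos
      (fun ρ ↦ Sekatskii.coe_ne_two_mul_sub ρ a (1 / 2)) (Sekatskii.summable_weight_zetaZeros a (1 / 2))

/-- **`k_{n,a}` bounded below ⟹ RH** (`a ≠ ½`): a lower bound `−K`, uniform in `n ≥ 1`, for Sekatskii's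
sums already implies the Riemann hypothesis (the constant-bound case of Theorem 2 (c) for the zeros of
`ζ`). PROVED. [cite: Sekatskii2014, Thm 1 with Thm 2 (c) (constant lower bound)] -/
theorem riemannHypothesis_of_liSekatskiiSum_bddBelow {a : ℝ} (ha : a ≠ 1 / 2) {K : ℝ}
    (hK : ∀ n : ℕ, 1 ≤ n → -K ≤ liSekatskiiSum a n) : RiemannHypothesis := by
  simp only [Sekatskii.liSekatskiiSum_eq_tsum] at hK
  rcases lt_or_gt_of_ne ha with hlt | hgt
  · rw [Sekatskii.riemannHypothesis_iff_forall_re_le_half]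
    exact sekatskii2014_thm2_of_bddBelow_lt (fun ρ : ZetaZeros.riemannZetaNontrivialZeros ↦ (ρ : ℂ))
      (fun ρ ↦ (riemannZetaZeroOrder (ρ : ℂ)).toNat) hlt Sekatskii.toNat_order_pos
      (fun ρ ↦ Sekatskii.coe_ne_two_mul_sub ρ a (1 / 2)) (Sekatskii.summable_weight_zetaZeros a (1 / 2)) hK
  · rw [Sekatskii.riemannHypothesis_iff_forall_half_le_re]
    exact sekatskii2014_thm2_of_bddBelow_gt (fun ρ : ZetaZeros.riemannZetaNontrivialZeros ↦ (ρ : ℂ))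
      (fun ρ ↦ (riemannZetaZeroOrder (ρ : ℂ)).toNat) hgt Sekatskii.toNat_order_pos
      (fun ρ ↦ Sekatskii.coe_ne_two_mul_sub ρ a (1 / 2)) (Sekatskii.summable_weight_zetaZeros a (1 / 2)) hK

/-- **Sub-exponential lower bounds for `k_{n,a}` ⟹ RH**, CONDITIONAL on the named fact
`Sekatskii2014_thm2c` (Theorem 2 (c) ⟹ (a)): if for every `ε > 0` there is `c(ε) > 0` with
`k_{n,a} ≥ −c(ε)e^{εn}` for all `n ≥ 1` (`a ≠ ½`), then RH. [cite: Sekatskii2014, Thm 1 with Thm 2 (c)] -/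
theorem riemannHypothesis_of_liSekatskiiSum_subexp (h2c : Sekatskii2014_thm2c.{0}) {a : ℝ}
    (ha : a ≠ 1 / 2)
    (hc : ∀ ε : ℝ, 0 < ε → ∃ c : ℝ, 0 < c ∧ ∀ n : ℕ, 1 ≤ n →
      -c * Real.exp (ε * n) ≤ liSekatskiiSum a n) : RiemannHypothesis := by
  simp only [Sekatskii.liSekatskiiSum_eq_tsum] at hc
  have h := h2c (fun ρ : ZetaZeros.riemannZetaNontrivialZeros ↦ (ρ : ℂ))
    (fun ρ ↦ (riemannZetaZeroOrder (ρ : ℂ)).toNat) a (1 / 2) ha Sekatskii.toNat_order_pos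
    (fun ρ ↦ Sekatskii.coe_ne_two_mul_sub ρ a (1 / 2)) (Sekatskii.summable_weight_zetaZeros a (1 / 2)) hc
  rcases lt_or_gt_of_ne ha with hlt | hgt
  · exact Sekatskii.riemannHypothesis_iff_forall_re_le_half.2 (h.1 hlt)
  · exact Sekatskii.riemannHypothesis_iff_forall_half_le_re.2 (h.2 hgt)

/-! ### `k_{n,1} = k_{n,0} = λ_n` and the symmetry `a ↦ 1 − a` -/

/-- **`k_{n,1} = λ_n`** (`n ≥ 1`): at `a = 1` the ratio is `(ρ − 1)/ρ = 1 − 1/ρ`, and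
`λ_n = Σ' ρ, m(ρ)·Re[1 − (1 − 1/ρ)ⁿ]` is the tree's `keiperLiCoeff_eq_tsum_zeros` (Li 1997 (1.4)).
[cite: Sekatskii2014, §1–2 (Li's `λ_n` as the case of the criterion at `a = 1`)] -/
theorem liSekatskiiSum_one {n : ℕ} (hn : 1 ≤ n) : liSekatskiiSum 1 n = keiperLiCoeff n := by
  rw [keiperLiCoeff_eq_tsum_zeros hn, liSekatskiiSum]
  refine tsum_congr fun ρ ↦ ?_
  have h0 : (ρ : ℂ) ≠ 0 := by
    intro h
    have := ZetaZeros.riemannZetaNontrivialZeros.re_pos ρ.2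
    rw [h, zero_re] at this
    exact lt_irrefl _ this
  congr 3
  push_cast
  field_simp
  ring

namespace Sekatskii

/-- The reflection `ρ ↦ 1 − ρ` as a permutation of the non-trivial zeros of `ζ`. [folklore] -/
def oneSub : ZetaZeros.riemannZetaNontrivialZeros ≃ ZetaZeros.riemannZetaNontrivialZeros where
  toFun ρ := ⟨1 - (ρ : ℂ), by
    have h := ZetaZeros.riemannZetaNontrivialZeros.one_sub_conj_mem
      (ZetaZeros.riemannZetaNontrivialZeros.conj_mem ρ.2)
    simpa using h⟩
  invFun ρ := ⟨1 - (ρ : ℂ), by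
    have h := ZetaZeros.riemannZetaNontrivialZeros.one_sub_conj_mem
      (ZetaZeros.riemannZetaNontrivialZeros.conj_mem ρ.2)
    simpa using h⟩
  left_inv ρ := by ext; simp
  right_inv ρ := by ext; simp

/-- `oneSub ρ = 1 − ρ` on the underlying complex numbers. [folklore] -/
@[simp] private theorem coe_oneSub (ρ : ZetaZeros.riemannZetaNontrivialZeros) :
    ((oneSub ρ : ZetaZeros.riemannZetaNontrivialZeros) : ℂ) = 1 - (ρ : ℂ) := rfl

/-- `m(1 − ρ) = m(ρ)` for a non-trivial zero (tree `riemannZetaZeroOrder_one_sub_holds`).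
[cite: Titchmarsh1986, §2.12] -/
theorem order_oneSub (ρ : ZetaZeros.riemannZetaNontrivialZeros) :
    riemannZetaZeroOrder ((oneSub ρ : ZetaZeros.riemannZetaNontrivialZeros) : ℂ) =
      riemannZetaZeroOrder (ρ : ℂ) := by
  rw [coe_oneSub]
  exact riemannZetaZeroOrder_one_sub_holds (ZetaZeros.riemannZetaNontrivialZeros.re_pos ρ.2)
    (ZetaZeros.riemannZetaNontrivialZeros.re_lt_one ρ.2)

end Sekatskii

/-- **`k_{n,1−a} = k_{n,a}`**: replacing `a` by `1 − a` inverts the ratio,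
`(ρ − (1−a))/(ρ + (1−a) − 1) = (ρ + a − 1)/(ρ − a)`, and the reflection `ρ ↦ 1 − ρ` of the zeros (with
`m(1 − ρ) = m(ρ)`) maps one sum onto the other; this is the first equality
`Σ_ρ (1 − ((ρ−a)/(ρ+a−1))ⁿ) = Σ_ρ (1 − ((ρ+a−1)/(ρ−a))ⁿ)` of the paper's (10). PROVED.
[cite: Sekatskii2014, Thm 7, eq. (10), first equality] -/
theorem liSekatskiiSum_one_sub (a : ℝ) (n : ℕ) : liSekatskiiSum (1 - a) n = liSekatskiiSum a n := by
  unfold liSekatskiiSum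
  rw [← Sekatskii.oneSub.tsum_eq]
  refine tsum_congr fun ρ ↦ ?_
  rw [Sekatskii.order_oneSub, Sekatskii.coe_oneSub]
  have hratio : ((1 - (ρ : ℂ)) - ((1 - a : ℝ) : ℂ)) / ((1 - (ρ : ℂ)) + ((1 - a : ℝ) : ℂ) - 1) =
      ((ρ : ℂ) - a) / ((ρ : ℂ) + a - 1) := by
    push_cast
    by_cases hρa : (ρ : ℂ) = a
    · -- then `1 − ρ = 1 − a`: both ratios have a vanishing numerator
      rw [hρa]; ring
    by_cases hρb : (ρ : ℂ) = 1 - a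
    · -- then both denominators vanish (Lean's `x/0 = 0` on both sides)
      have h1 : (1 - (ρ : ℂ)) + (1 - (a : ℂ)) - 1 = 0 := by rw [hρb]; ring
      have h2 : (ρ : ℂ) + a - 1 = 0 := by rw [hρb]; ring
      rw [h1, h2, div_zero, div_zero]
    · have h3 : (1 - (ρ : ℂ)) + (1 - (a : ℂ)) - 1 ≠ 0 := by
        intro h; apply hρb; linear_combination (-1 : ℂ) * h
      have h4 : (ρ : ℂ) + a - 1 ≠ 0 := by
        intro h; apply hρb; linear_combination h
      rw [div_eq_div_iff h3 h4]
      ring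
  rw [hratio]

/-- **`k_{n,0} = λ_n`** (`n ≥ 1`): `liSekatskiiSum_one_sub` with `a = 1` and `liSekatskiiSum_one`; at
`a = 0` Sekatskii's derivative `(1/(n−1)!) dⁿ/dzⁿ[(z − a)^{n−1} log ξ(z)]|_{z=1−a}` is literally Li's
(1.1). [cite: Sekatskii2014, Thm 1 and eq. (1)] -/
theorem liSekatskiiSum_zero {n : ℕ} (hn : 1 ≤ n) : liSekatskiiSum 0 n = keiperLiCoeff n := by
  rw [← liSekatskiiSum_one hn, ← liSekatskiiSum_one_sub 1 n, sub_self]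

/-! ### Discharge of `Sekatskii2014_thm2c` (condition (c) ⟹ (a)/(a′)) -/

namespace Sekatskii

variable {ι : Type*} {ρ : ι → ℂ} {m : ι → ℕ} {a σ : ℝ}

/-- Core of (c) ⟹ (a): if Sekatskii's sums are `≥ −c(ε)e^{εn}` for every `ε > 0` then every rescaled
member has `Re ρ′ ≤ ½` — transport of the tree's `bombieriLagarias1999_theorem1_of_subexp`
(Bombieri–Lagarias (3) ⟹ (1)); the finitely many members at `a` shift the constant `c(ε)` by
`Σ_{ρ_i = a} m_i`. [cite: Sekatskii2014, Thm 2 (c)] -/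
theorem rescale_re_le_half_of_subexp (h : a ≠ σ) (hm : ∀ i, 0 < m i) (h1 : ∀ i, ρ i ≠ 2 * σ - a)
    (hR : Summable (weight a σ ρ m))
    (hc : ∀ ε : ℝ, 0 < ε → ∃ c : ℝ, 0 < c ∧ ∀ n : ℕ, 1 ≤ n →
      -c * Real.exp (ε * n) ≤ ∑' i, (m i : ℝ) * (1 - ((ρ i - a) / (ρ i + a - 2 * σ)) ^ n).re) :
    ∀ i, (rescale a σ (ρ i)).re ≤ 1 / 2 := by
  have hE0 : 0 ≤ ∑' i, extra a ρ m i := tsum_nonneg (extra_nonneg a ρ m)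
  refine bombieriLagarias1999_theorem1_of_subexp (fun i ↦ rescale a σ (ρ i)) m hm
    (fun i ↦ rescale_ne_one h (h1 i)) (summable_blWeight h hR) fun ε hε ↦ ?_
  obtain ⟨c, hc0, hcn⟩ := hc ε hε
  refine ⟨c + ∑' i, extra a ρ m i, by positivity, fun n hn ↦ ?_⟩
  have h2 := hcn n hn
  rw [tsum_term_eq h hm hR hn] at h2
  have hexp1 : 1 ≤ Real.exp (ε * n) := Real.one_le_exp (by positivity)
  nlinarith

end Sekatskii

universe u in
/-- **Discharge of `Sekatskii2014_thm2c`**: Theorem 2, (c) ⟹ (a) (for `a < σ`) and (c) ⟹ (a′) (for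
`a > σ`), PROVED — Bombieri–Lagarias' condition (3) (`bombieriLagarias1999_theorem1_of_subexp`, the
B–L 1999 §2 argument with the exponential main term kept) transported along `ρ ↦ (ρ−a)/(2(σ−a))`.
[cite: Sekatskii2014, Thm 2 (c)] -/
theorem Sekatskii2014_thm2c_holds : Sekatskii2014_thm2c.{u} := by
  intro ι ρ m a σ haσ hm h1 hR hc
  constructor
  · intro hlt i
    exact (Sekatskii.rescale_re_le_half_iff_of_lt hlt _).1
      (Sekatskii.rescale_re_le_half_of_subexp haσ hm h1 hR hc i)
  · intro hgt i
    exact (Sekatskii.rescale_re_le_half_iff_of_gt hgt _).1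
      (Sekatskii.rescale_re_le_half_of_subexp haσ hm h1 hR hc i)

/-- **Sub-exponential lower bounds for `k_{n,a}` ⟹ RH, unconditionally** (`a ≠ ½`): if for every
`ε > 0` there is `c(ε) > 0` with `k_{n,a} ≥ −c(ε)e^{εn}` for all `n ≥ 1`, then the Riemann hypothesis
holds (for `a ∈ {0, 1}`: "`λ_n ≥ −c(ε)e^{εn}` for every `ε > 0` implies RH", Bombieri–Lagarias'
Thm 1 (c) ⟹ (a) for the zeros of `ξ`). PROVED. [cite: Sekatskii2014, Thm 1 and Thm 2 (c); BombieriLagarias1999, Theorem 1] -/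
theorem riemannHypothesis_of_liSekatskiiSum_subexp' {a : ℝ} (ha : a ≠ 1 / 2)
    (hc : ∀ ε : ℝ, 0 < ε → ∃ c : ℝ, 0 < c ∧ ∀ n : ℕ, 1 ≤ n →
      -c * Real.exp (ε * n) ≤ liSekatskiiSum a n) : RiemannHypothesis :=
  riemannHypothesis_of_liSekatskiiSum_subexp Sekatskii2014_thm2c_holds ha hc

/-- **`λ_n ≥ −c(ε)e^{εn}` for every `ε > 0` ⟹ RH** (Bombieri–Lagarias 1999, Thm 1 (c) ⟹ (a) for the
zeros of `ξ`; `λ_n = keiperLiCoeff n = k_{n,1}`). PROVED.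
[cite: BombieriLagarias1999, Theorem 1; Sekatskii2014, Thm 2 (c)] -/
theorem riemannHypothesis_of_keiperLiCoeff_subexp
    (hc : ∀ ε : ℝ, 0 < ε → ∃ c : ℝ, 0 < c ∧ ∀ n : ℕ, 1 ≤ n →
      -c * Real.exp (ε * n) ≤ keiperLiCoeff n) : RiemannHypothesis := by
  refine riemannHypothesis_of_liSekatskiiSum_subexp' (a := 1) (by norm_num) fun ε hε ↦ ?_
  obtain ⟨c, hc0, hcn⟩ := hc ε hε
  exact ⟨c, hc0, fun n hn ↦ by rw [liSekatskiiSum_one hn]; exact hcn n hn⟩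

end Literature.NumberTheory.LFunctions
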